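import Literature.Analysis.FluidPDE.SuitableWeakRescaling
import Summits.NavierStokesRegularity.NavierStokesRegularity.Theorems.AdaptedFrequencyFrequencyRigidityTypeIBoundTimeDilation
import HarnessLib

/-!
# Crux `FrequencyRigidity` (stmt-NavierStokesRegularity-2955), line `scaled-energy-split`:
# the Albritton–Barker clause under the viscosity (time) dilation

Helper file (`--supports stmt-NavierStokesRegularity-2955`; theorems only).  Sub-goal (W4)
`finiteAB_abClause_dilate` of the enabler `tangentFlowTransfer_finiteAB`: the Albritton–Barker
clause of a field `W` on the slab `ℝ³ × ℝ₋` at viscosity `ν₀` — a suitable pressure `ϖ`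
(`IsSuitableWeakSolutionOn`, Caffarelli–Kohn–Nirenberg 1982, (2.1)–(2.5)), a weak spatial
gradient `H` (`HasWeakSpatialGradientOn`) and a finite A–B quantity
`𝐈(ℝ³ × ℝ₋; W, ϖ, H) < ∞` (`typeIBound (Iio 0 ×ˢ univ)`) — passes, for every `β > 0`, to the
time-dilated triple `(β W(β t, x), β² ϖ(β t, x), β H(β t, x))` at viscosity `β ν₀`
(in the tree's rescaling vocabulary: `β • stPull β 1 0 0 W`, `β ^ 2 • stPull β 1 0 0 ϖ`,
`β • stPull β 1 0 0 H`).  With `(ν₀, β) = (1, ν)` this returns the unit-viscosity tangent flow to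
viscosity `ν`; with `(ν₀, β) = (ν, ν⁻¹)` it normalises a viscosity-`ν` witness to unit viscosity.

Proof.  Three tree covariance theorems with `α = β`, `γ = 1`, `(t₀, x₀) = (0, 0)`:
`IsSuitableWeakSolutionOn.stRescale` (new viscosity `β ν₀ / 1`, new force
`(β² · 1) • stPull β 1 0 0 0 = 0`), `HasWeakSpatialGradientOn.stRescale` (new gradient
`(β · 1) • stPull β 1 0 0 H`), both on the domain `Φ⁻¹(ℝ³ × ℝ₋) = ℝ³ × ℝ₋` for
`Φ(s, y) = (β s, y)`, `β > 0`; and `stub_typeIBound_timeDilation` (the A–B quantity stays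
finite under `(a u(β t, x), b p(β t, x), a G(β t, x))`) with `a = β`, `b = β²`.

## References

* L. Caffarelli, R. Kohn, L. Nirenberg, *Partial regularity of suitable weak solutions of the
  Navier–Stokes equations*, Comm. Pure Appl. Math. 35 (1982), §2 (scaling remarks after (2.6)).
* D. Albritton, T. Barker, *On local Type I singularities of the Navier–Stokes equations and
  Liouville theorems*, J. Math. Fluid Mech. 21 (2019), §1 and §3. [AlbrittonBarker2019]
-/

noncomputable section

set_option linter.dupNamespace false

namespace Summit.NavierStokesRegularity.NavierStokesRegularity.Theorems

open Literature.Analysis Literature.Analysis.FluidPDE MeasureTheory Set Filter Topology Function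
open Summit.NavierStokesRegularity.NavierStokesRegularity.Theorems.FrequencyRigidity.ScaledEnergySplit
open scoped ENNReal NNReal

/-- The lower half space–time `ℝ³ × ℝ₋ = (-∞, 0) × ℝ³` is invariant under the pure time dilation
`Φ(s, y) = (β s, y)`, `β > 0`: `Φ⁻¹((-∞, 0) × ℝ³) = (-∞, 0) × ℝ³` as open sets. [folklore] -/
theorem finiteAB_stPreimage_timeDil_lowerSlab {β : ℝ} (hβ : 0 < β) :
    stPreimage β 1 0 (0 : EuclideanSpace ℝ (Fin 3))
        (slab (EuclideanSpace ℝ (Fin 3)) (Iio 0) isOpen_Iio) =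
      slab (EuclideanSpace ℝ (Fin 3)) (Iio 0) isOpen_Iio := by
  refine TopologicalSpace.Opens.ext (Set.ext fun z => ?_)
  simp only [coe_stPreimage, coe_slab, mem_preimage, mem_prod, mem_univ, and_true, stAffine_fst,
    mem_Iio, zero_add]
  constructor
  · intro h
    by_contra hz
    exact absurd h (not_lt.2 (mul_nonneg hβ.le (not_lt.1 hz)))
  · intro h
    exact mul_neg_of_pos_of_neg hβ h

/-- **(W4) The Albritton–Barker clause under the viscosity dilation.** If `(W, ϖ)` is a suitable
weak solution of the unforced Navier–Stokes system with viscosity `ν₀ > 0` on the slab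
`ℝ³ × ℝ₋` (Caffarelli–Kohn–Nirenberg 1982, (2.1)–(2.5)), `H` is a weak spatial gradient of `W`
there, and the Albritton–Barker quantity `𝐈(ℝ³ × ℝ₋; W, ϖ, H)` is finite, then for every `β > 0`
the time-dilated triple `(β W(β t, x), β² ϖ(β t, x), β H(β t, x))` is a suitable weak solution
with viscosity `β ν₀` and zero force on the same slab, `β H(β ·, ·)` is a weak spatial gradient of
`β W(β ·, ·)` there, and its Albritton–Barker quantity is again finite (covariance of suitable
weak solutions and weak gradients under `Φ(s, y) = (β s, y)` with amplitude `β`, CKN 1982, §2;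
finiteness of `𝐈` under time dilation by the covering of a dilated parabolic ball by `⌈2β⌉`
parabolic balls, Albritton–Barker 2019, §1). [cite: CaffarelliKohnNirenberg1982, §2] -/
theorem finiteAB_abClause_dilate : ∀ (ν₀ β : ℝ), 0 < ν₀ → 0 < β → ∀ (W : ℝ → EuclideanSpace ℝ (Fin 3) → EuclideanSpace ℝ (Fin 3)) (ϖ : ℝ → EuclideanSpace ℝ (Fin 3) → ℝ) (H : ℝ → EuclideanSpace ℝ (Fin 3) → EuclideanSpace ℝ (Fin 3) →L[ℝ] EuclideanSpace ℝ (Fin 3)), Literature.Analysis.FluidPDE.IsSuitableWeakSolutionOn (Literature.Analysis.FluidPDE.slab (EuclideanSpace ℝ (Fin 3)) (Set.Iio 0) isOpen_Iio) ν₀ 0 W ϖ → Literature.Analysis.FluidPDE.HasWeakSpatialGradientOn (Literature.Analysis.FluidPDE.slab (EuclideanSpace ℝ (Fin 3)) (Set.Iio 0) isOpen_Iio) W H → Literature.Analysis.FluidPDE.typeIBound (Set.Iio (0:ℝ) ×ˢ Set.univ) W ϖ H < ⊤ → Literature.Analysis.FluidPDE.IsSuitableWeakSolutionOn (Literature.Analysis.FluidPDE.slab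 (EuclideanSpace ℝ (Fin 3)) (Set.Iio 0) isOpen_Iio) (β * ν₀) 0 (β • Literature.Analysis.FluidPDE.stPull β 1 0 0 W) (β ^ 2 • Literature.Analysis.FluidPDE.stPull β 1 0 0 ϖ) ∧ Literature.Analysis.FluidPDE.HasWeakSpatialGradientOn (Literature.Analysis.FluidPDE.slab (EuclideanSpace ℝ (Fin 3)) (Set.Iio 0) isOpen_Iio) (β • Literature.Analysis.FluidPDE.stPull β 1 0 0 W) (β • Literature.Analysis.FluidPDE.stPull β 1 0 0 H) ∧ Literature.Analysis.FluidPDE.typeIBound (Set.Iio (0:ℝ) ×ˢ Set.univ) (β • Literature.Analysis.FluidPDE.stPull β 1 0 0 W) (β ^ 2 • Literature.Analysis.FluidPDE.stPull β 1 0 0 ϖ) (β • Literature.Analysis.FluidPDE.stPull β 1 0 0 H) < ⊤ := by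
  intro ν₀ β hν₀ hβ W ϖ H hsw hgrad hI
  have hslab := finiteAB_stPreimage_timeDil_lowerSlab hβ
  refine ⟨?_, ?_, ?_⟩
  · -- covariance of suitable weak solutions, `α = β`, `γ = 1`
    have h1 := hsw.stRescale (α := β) (β := β) (γ := 1) hβ one_pos (mul_one β).symm 0 0
    have hf : ((β ^ 2 * 1) • stPull β 1 0 (0 : EuclideanSpace ℝ (Fin 3))
        (0 : ℝ → EuclideanSpace ℝ (Fin 3) → EuclideanSpace ℝ (Fin 3))) = 0 := by
      funext s y
      simp only [smul_stPull_apply, Pi.zero_apply, smul_zero]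
    rw [hslab, hf, div_one] at h1
    exact h1
  · -- covariance of weak spatial gradients
    have h2 := hgrad.stRescale β hβ one_pos 0 0
    rw [hslab, mul_one] at h2
    exact h2
  · -- the A–B quantity under time dilation, `a = β`, `b = β ^ 2`
    have h3 := stub_typeIBound_timeDilation β β (β ^ 2) W ϖ H hβ hI
    have e1 : (β • stPull β 1 0 (0 : EuclideanSpace ℝ (Fin 3)) W) = fun t x => β • W (β * t) x := by
      funext t x
      simp only [smul_stPull_apply, zero_add, one_smul]
    have e2 : (β ^ 2 • stPull β 1 0 (0 : EuclideanSpace ℝ (Fin 3)) ϖ) =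
        fun t x => β ^ 2 * ϖ (β * t) x := by
      funext t x
      simp only [smul_stPull_apply, zero_add, one_smul, smul_eq_mul]
    have e3 : (β • stPull β 1 0 (0 : EuclideanSpace ℝ (Fin 3)) H) = fun t x => β • H (β * t) x := by
      funext t x
      simp only [Pi.smul_apply, stPull_apply, zero_add, one_smul]
    rw [e1, e2, e3]
    exact h3

end Summit.NavierStokesRegularity.NavierStokesRegularity.Theorems

end
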